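import Mathlib

/-!
# Two-constants estimate along a chain of discs (the "harmonic measure engine", holomorphic form)

Helper file for item `stmt-QuantumFields-18844` (`HarmonicMeasureEngine`, route `ComplexCouplingChannel` of
`QuantumFields/YangMills`).  The route's engine transports exponential smallness of a holomorphic function
from the strong-coupling disc to a real coupling `β` through an open connected channel `D ⊆ ℂ`, by the
two-constants theorem (harmonic measure).  Harmonic measure is not in Mathlib; the route's intended
substitute is a CHAIN OF HADAMARD THREE-CIRCLES estimates.  This file proves exactly that, in the form the
torus leg of the engine consumes:

* `norm_le_sqrt_of_three_circles` — one disc step (Hadamard three circles with radii `ρ, 2ρ, 4ρ`, from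
  Mathlib's three-lines theorem composed with `exp`): if `h` is holomorphic on a neighbourhood of
  `closedBall c (4ρ)`, `‖h‖ ≤ K` there and `‖h‖ ≤ ε ≤ K` on `closedBall c ρ`, then `‖h‖ ≤ √(ε K)` on
  `closedBall c (2ρ)`;
* `exists_exponent_norm_le_rpow_mul_rpow` — the chain: for an open preconnected `D`, points `x, β ∈ D`
  and a radius `r₀ > 0` there is an exponent `θ ∈ (0, 1]`, depending only on `(D, x, r₀, β)` and NOT on
  the function, such that every `h` holomorphic on `D` with `‖h‖ ≤ K` on `D` and `‖h‖ ≤ ε ≤ K` on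
  `D ∩ ball x r₀` satisfies `‖h β‖ ≤ ε ^ θ * K ^ (1 - θ)` (`θ = 2^{-k}`, `k` the number of discs of a chain
  from `x` to `β` inside `D`).  Since `θ` is uniform in `h`, a family `h_P` with `ε = A e^{-cP}` decays like
  `e^{-cθP}` at `β` — the "exponentially small weak-coupling scale manufactured by harmonic measure".

References: R. Nevanlinna, *Eindeutige analytische Funktionen* (1936), §III.2 (two-constants theorem);
T. Ransford, *Potential theory in the complex plane* (1995), §4.3; J. Hadamard (1896) (three circles);
Mathlib `Complex.HadamardThreeLines`.
-/

open Complex Metric Set Filter Topology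

namespace Summit.QuantumFields.YangMills.Theorems.ComplexCouplingChannel

/-- Monotonicity of the two-constants interpolant: for `0 < ε ≤ K` and `τ ≤ 1/2`,
`ε^{1-τ} K^{τ} ≤ ε^{1/2} K^{1/2}` (any `τ ≤ 1/2`). [folklore] -/
theorem rpow_interp_le_sqrt {ε K τ : ℝ} (hε : 0 < ε) (hεK : ε ≤ K) (hτ2 : τ ≤ 1 / 2) :
    ε ^ (1 - τ) * K ^ τ ≤ ε ^ (1 / 2 : ℝ) * K ^ (1 / 2 : ℝ) := by
  have hK : 0 < K := lt_of_lt_of_le hε hεK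
  have h1 : ε ^ (1 - τ) = ε ^ (1 / 2 : ℝ) * ε ^ (1 / 2 - τ) := by
    rw [← Real.rpow_add hε]; congr 1; ring
  have h2 : K ^ (1 / 2 : ℝ) = K ^ (1 / 2 - τ) * K ^ τ := by
    rw [← Real.rpow_add hK]; congr 1; ring
  rw [h1, h2, mul_assoc]
  refine mul_le_mul_of_nonneg_left ?_ (Real.rpow_nonneg hε.le _)
  exact mul_le_mul_of_nonneg_right
    (Real.rpow_le_rpow hε.le hεK (by linarith)) (Real.rpow_nonneg hK.le _)

/-- **One disc step (Hadamard three circles with radii `ρ, 2ρ, 4ρ`).**  Let `h` be complex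
differentiable on an open set `D` containing `closedBall c (4ρ)`, with `‖h‖ ≤ K` on that closed ball and
`‖h‖ ≤ ε` on `closedBall c ρ`, where `0 < ε ≤ K`.  Then `‖h z‖ ≤ ε^{1/2} K^{1/2}` on `closedBall c (2ρ)`.
Proof: three-lines theorem for `w ↦ h (c + e^w)` on the strip `log ρ ≤ re w ≤ log (4ρ)`; the interpolation
exponent at `|z - c| ≤ 2ρ` is at most `log 2 / log 4 = 1/2`. [folklore] -/
theorem norm_le_sqrt_of_three_circles {D : Set ℂ} (hD : IsOpen D) {h : ℂ → ℂ}
    (hh : DifferentiableOn ℂ h D) {c : ℂ} {ρ K ε : ℝ} (hρ : 0 < ρ)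
    (hsub : closedBall c (4 * ρ) ⊆ D) (hε : 0 < ε) (hεK : ε ≤ K)
    (hK : ∀ z ∈ closedBall c (4 * ρ), ‖h z‖ ≤ K) (hsmall : ∀ z ∈ closedBall c ρ, ‖h z‖ ≤ ε)
    {z : ℂ} (hz : z ∈ closedBall c (2 * ρ)) :
    ‖h z‖ ≤ ε ^ (1 / 2 : ℝ) * K ^ (1 / 2 : ℝ) := by
  have hK0 : 0 < K := lt_of_lt_of_le hε hεK
  -- the trivial case `|z - c| ≤ ρ`
  by_cases hzc : dist z c ≤ ρ
  · calc ‖h z‖ ≤ ε := hsmall z hzc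
      _ = ε ^ (1 / 2 : ℝ) * ε ^ (1 / 2 : ℝ) := by
          rw [← Real.rpow_add hε]; norm_num
      _ ≤ ε ^ (1 / 2 : ℝ) * K ^ (1 / 2 : ℝ) :=
          mul_le_mul_of_nonneg_left (Real.rpow_le_rpow hε.le hεK (by norm_num)) (Real.rpow_nonneg hε.le _)
  push Not at hzc
  have hz2 : dist z c ≤ 2 * ρ := hz
  have hzc0 : z - c ≠ 0 := by
    intro h0
    rw [dist_eq_norm, h0, norm_zero] at hzc
    exact (lt_irrefl _ (hρ.trans hzc))
  -- the pulled-back function on the strip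
  set l : ℝ := Real.log ρ with hl
  set u : ℝ := Real.log (4 * ρ) with hu
  have hlu : l < u := Real.log_lt_log hρ (by linarith)
  have hul : u - l = Real.log 4 := by
    rw [hu, hl, Real.log_mul (by norm_num) hρ.ne']; ring
  set g : ℂ → ℂ := fun w => h (c + exp w) with hg
  -- points of the closed strip land in the closed annulus `ρ ≤ |·| ≤ 4ρ`
  have hmem : ∀ w : ℂ, w ∈ HadamardThreeLines.verticalClosedStrip l u → c + exp w ∈ closedBall c (4 * ρ) := by
    intro w hw
    rw [mem_closedBall, dist_eq_norm, add_sub_cancel_left, norm_exp]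
    have h2 : w.re ≤ Real.log (4 * ρ) := hw.2
    calc Real.exp w.re ≤ Real.exp (Real.log (4 * ρ)) := Real.exp_le_exp.2 h2
      _ = 4 * ρ := Real.exp_log (by linarith)
  have hdiff : DifferentiableOn ℂ g (HadamardThreeLines.verticalClosedStrip l u) := by
    intro w hw
    have h1 : DifferentiableAt ℂ h (c + exp w) :=
      hh.differentiableAt (hD.mem_nhds (hsub (hmem w hw)))
    exact (h1.comp w ((differentiableAt_const c).add differentiableAt_exp)).differentiableWithinAt
  have hclosure : closure (HadamardThreeLines.verticalStrip l u) = HadamardThreeLines.verticalClosedStrip l u := by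
    rw [HadamardThreeLines.verticalStrip, HadamardThreeLines.verticalClosedStrip, closure_preimage_re, closure_Ioo hlu.ne]
  have hdc : DiffContOnCl ℂ g (HadamardThreeLines.verticalStrip l u) :=
    DifferentiableOn.diffContOnCl (by rw [hclosure]; exact hdiff)
  have hB : BddAbove ((norm ∘ g) '' HadamardThreeLines.verticalClosedStrip l u) := by
    refine ⟨K, ?_⟩
    rintro _ ⟨w, hw, rfl⟩
    exact hK _ (hmem w hw)
  have ha : ∀ w ∈ re ⁻¹' {l}, ‖g w‖ ≤ ε := by
    intro w hw
    have hw' : w.re = Real.log ρ := hw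
    refine hsmall _ ?_
    rw [mem_closedBall, dist_eq_norm, add_sub_cancel_left, norm_exp, hw', Real.exp_log hρ]
  have hb : ∀ w ∈ re ⁻¹' {u}, ‖g w‖ ≤ K := by
    intro w hw
    have hw' : w.re = Real.log (4 * ρ) := hw
    refine hK _ (hmem w ⟨?_, le_of_eq hw'⟩)
    rw [hw']; exact hlu.le
  -- the point `w₀ = log (z - c)` of the strip over `z`
  set w₀ : ℂ := log (z - c) with hw₀
  have hzexp : c + exp w₀ = z := by rw [hw₀, exp_log hzc0]; ring
  have hre : w₀.re = Real.log ‖z - c‖ := by rw [hw₀, log_re]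
  have hnorm : ‖z - c‖ = dist z c := (dist_eq_norm z c).symm
  have hw₀mem : w₀ ∈ HadamardThreeLines.verticalClosedStrip l u := by
    refine ⟨?_, ?_⟩
    · show l ≤ w₀.re
      rw [hre, hl, hnorm]; exact Real.log_le_log hρ hzc.le
    · show w₀.re ≤ u
      rw [hre, hu, hnorm]; exact Real.log_le_log (hρ.trans hzc) (by linarith)
  have key := HadamardThreeLines.norm_le_interp_of_mem_verticalClosedStrip' hlu hw₀mem hdc hB ha hb
  rw [show g w₀ = h z from by rw [hg]; exact congrArg h hzexp] at key
  -- the interpolation exponent is at most `1/2`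
  set τ : ℝ := (w₀.re - l) / (u - l) with hτ
  have hτ2 : τ ≤ 1 / 2 := by
    rw [hτ, div_le_iff₀ (by linarith), hul, hre, hl, hnorm]
    have h4 : Real.log 4 = 2 * Real.log 2 := by
      rw [show (4 : ℝ) = 2 ^ 2 from by norm_num, Real.log_pow]; ring
    have : Real.log (dist z c) ≤ Real.log (2 * ρ) := Real.log_le_log (hρ.trans hzc) hz2
    rw [Real.log_mul (by norm_num) hρ.ne'] at this
    linarith
  exact key.trans (rpow_interp_le_sqrt hε hεK hτ2)

/-- The exponent bookkeeping of one disc step: `(ε^a K^{1-a})^{1/2} K^{1/2} = ε^{a/2} K^{1-a/2}`. [folklore] -/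
theorem sqrt_interp_mul_sqrt {ε K a : ℝ} (hε : 0 < ε) (hK : 0 < K) :
    (ε ^ a * K ^ (1 - a)) ^ (1 / 2 : ℝ) * K ^ (1 / 2 : ℝ) = ε ^ (a * (1 / 2)) * K ^ (1 - a * (1 / 2)) := by
  rw [Real.mul_rpow (Real.rpow_nonneg hε.le _) (Real.rpow_nonneg hK.le _), ← Real.rpow_mul hε.le,
    ← Real.rpow_mul hK.le, mul_assoc, ← Real.rpow_add hK]
  congr 1; ring_nf

/-- **Two-constants estimate along a chain of discs (harmonic-measure surrogate).**  Let `D ⊆ ℂ` be open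
and preconnected, `x, β ∈ D`, `r₀ > 0`.  There is an exponent `θ ∈ (0, 1]` — depending only on
`(D, x, r₀, β)`, not on the function — such that for every `h` complex differentiable on `D` with `‖h‖ ≤ K`
on `D` and `‖h‖ ≤ ε` on `D ∩ ball x r₀`, where `0 < ε ≤ K`, one has `‖h β‖ ≤ ε ^ θ * K ^ (1 - θ)`.
Proof: join `x` to `β` by a path in `D` (open connected sets of `ℂ` are path connected), thicken its compact
range inside `D`, cover it by a chain of `N` discs of radius `ρ` with consecutive centres closer than `ρ`,
and iterate `norm_le_sqrt_of_three_circles`; `θ = 2^{-N}`.  This replaces the harmonic measure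
`ω(β, ∂B(x,r₀), D)` of the two-constants theorem (Nevanlinna; Ransford, *Potential theory in the
complex plane* (1995) §4.3) by the explicit lower bound `2^{-N}`. [folklore] -/
theorem exists_exponent_norm_le_rpow_mul_rpow {D : Set ℂ} (hD : IsOpen D) (hDc : IsPreconnected D)
    {x β : ℂ} (hx : x ∈ D) (hβ : β ∈ D) {r₀ : ℝ} (hr₀ : 0 < r₀) :
    ∃ θ : ℝ, 0 < θ ∧ θ ≤ 1 ∧ ∀ (h : ℂ → ℂ) (K ε : ℝ), DifferentiableOn ℂ h D → 0 < ε → ε ≤ K →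
      (∀ z ∈ D, ‖h z‖ ≤ K) → (∀ z ∈ D, dist z x < r₀ → ‖h z‖ ≤ ε) →
        ‖h β‖ ≤ ε ^ θ * K ^ (1 - θ) := by
  -- a path from `x` to `β` inside `D`
  have hpath : IsPathConnected D := hD.isConnected_iff_isPathConnected.1 ⟨⟨x, hx⟩, hDc⟩
  have hJ : JoinedIn D x β := hpath.joinedIn x hx β hβ
  set γ : Path x β := hJ.somePath with hγ
  have hγD : ∀ t, γ t ∈ D := hJ.somePath_mem
  -- a closed thickening of its compact range inside `D`
  obtain ⟨δ, hδ0, hδD⟩ := (isCompact_range γ.continuous).exists_cthickening_subset_open hD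
    (range_subset_iff.2 hγD)
  -- the disc radius
  set ρ : ℝ := min δ r₀ / 4 with hρ
  have hmin : 0 < min δ r₀ := lt_min hδ0 hr₀
  have hρ0 : 0 < ρ := by rw [hρ]; positivity
  have hρδ : 4 * ρ ≤ δ := by rw [hρ]; linarith [min_le_left δ r₀]
  have hρr : ρ < r₀ := by rw [hρ]; linarith [min_le_right δ r₀]
  -- the spacing of the chain, from uniform continuity of the extended path
  obtain ⟨η, hη0, hη⟩ := Metric.uniformContinuous_iff.1 γ.uniformContinuous_extend ρ hρ0
  obtain ⟨k, hk⟩ := exists_nat_one_div_lt hη0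
  set N : ℕ := k + 1 with hN
  have hN0 : (0 : ℝ) < N := by rw [hN]; positivity
  have hNinv : 1 / (N : ℝ) < η := by rw [hN]; push_cast; exact hk
  -- the centres
  set c : ℕ → ℂ := fun j => γ.extend ((j : ℝ) / N) with hc
  have hcmem : ∀ j, c j ∈ range γ := fun j => by
    rw [← γ.extend_range]; exact mem_range_self _
  have hc0 : c 0 = x := by simp [hc]
  have hcN : c N = β := by
    simp only [hc]
    rw [div_self hN0.ne', Path.extend_one]
  have hstep : ∀ j : ℕ, dist (c (j + 1)) (c j) < ρ := by
    intro j
    refine hη ?_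
    rw [Real.dist_eq, Nat.cast_succ, show ((j : ℝ) + 1) / N - j / N = 1 / N from by ring,
      abs_of_pos (by positivity)]
    exact hNinv
  have hball : ∀ j, closedBall (c j) (4 * ρ) ⊆ D := fun j =>
    (closedBall_subset_closedBall hρδ).trans ((closedBall_subset_cthickening (hcmem j) δ).trans hδD)
  -- the exponent `2^{-N}`
  refine ⟨(1 / 2 : ℝ) ^ N, by positivity, pow_le_one₀ (by norm_num) (by norm_num), ?_⟩
  intro h K ε hh hε hεK hK hsmall
  have hK0 : 0 < K := lt_of_lt_of_le hε hεK
  -- propagation along the chain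
  have hind : ∀ j : ℕ, ∀ z ∈ closedBall (c j) ρ,
      ‖h z‖ ≤ ε ^ ((1 / 2 : ℝ) ^ j) * K ^ (1 - (1 / 2 : ℝ) ^ j) := by
    intro j
    induction j with
    | zero =>
      intro z hz
      rw [pow_zero, Real.rpow_one, sub_self, Real.rpow_zero, mul_one]
      refine hsmall z (hball 0 ((closedBall_subset_closedBall (by linarith)) hz)) ?_
      rw [hc0] at hz
      exact lt_of_le_of_lt hz hρr
    | succ j ih =>
      intro z hz
      set a : ℝ := (1 / 2 : ℝ) ^ j with ha
      have ha0 : 0 ≤ a := by rw [ha]; positivity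
      have hε'0 : 0 < ε ^ a * K ^ (1 - a) := mul_pos (Real.rpow_pos_of_pos hε _) (Real.rpow_pos_of_pos hK0 _)
      have hε'K : ε ^ a * K ^ (1 - a) ≤ K := by
        calc ε ^ a * K ^ (1 - a) ≤ K ^ a * K ^ (1 - a) :=
              mul_le_mul_of_nonneg_right (Real.rpow_le_rpow hε.le hεK ha0) (Real.rpow_nonneg hK0.le _)
          _ = K := by rw [← Real.rpow_add hK0]; simp
      have hz' : z ∈ closedBall (c j) (2 * ρ) := by
        rw [mem_closedBall]
        calc dist z (c j) ≤ dist z (c (j + 1)) + dist (c (j + 1)) (c j) := dist_triangle _ _ _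
          _ ≤ ρ + ρ := add_le_add hz (hstep j).le
          _ = 2 * ρ := by ring
      have key := norm_le_sqrt_of_three_circles hD hh hρ0 (hball j) hε'0 hε'K
        (fun w hw => hK w (hball j hw)) ih hz'
      rw [sqrt_interp_mul_sqrt hε hK0, ← pow_succ] at key
      exact key
  have hβmem : β ∈ closedBall (c N) ρ := by
    rw [hcN]; exact mem_closedBall_self hρ0.le
  exact hind N β hβmem

end Summit.QuantumFields.YangMills.Theorems.ComplexCouplingChannel
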